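import Literature.MathematicalPhysics.QuantumFieldTheory.Balaban1983to89.Node00.Record13SepBgRowOfThm1C
import Summits.QuantumFields.YangMills.Theorems.BalabanUVNodesN11OneBlockLevels

/-!
# DAG node N11 × NODE 00 — «BG-ONEBLOCK»: K0's ROW P11 `bg` WITHOUT THE RUN GUARD at every power-of-`L` basic cube — node00-def-P11's ∕ K0a's faithful chain
# (`bgRowAt_of_classBounds` → `bgRowAt_of_thm1ScaledSep` → `Stage13Params.bgSepAt_of_thm1ScaledSep`) consumes the partition compatibility (C2) = `PartCompat₁₃` at EXACTLY ONE
# place (`hcubeΩ`: every (1.12) `L^{j+1}M`-cube meeting `X ⊆ Λ_j(s)` lies in `Ω_j(s)`), and that place is the saturation lemma which p618164 proved «compatible OR one-block»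

HEADER — WORK-UNIT METADATA.  Cell `pub-ymgap`, YM-PLAN Track A (HUMAN RULING D-0062 ∕ D-0149 width seats), seat `pub-ymgap-dag-n11-w4` (g4; WIDTH SEAT 4 of 4 on NODE n11
[B14]), route `BalabanUVNodes` rev 27, deciding item K1⁸ `StabilityBRunRowsAtRecordR13SepCoPH` = stmt-QuantumFields-26907 (helper lane, `--kind proof --supports 26907 --as helper`,
count-neutral).  The located supplier piece «BG-ONEBLOCK» of plan g85 WORD-2 (bus l.34912: «`BgProvisoΛ … n (supp) (UbgOfRecord₁₃CoP θ p n)` at levels with `cubeIndices = {0}` on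
window runs … lanes K0a ∕ dag-n07 ∕ n11»).  [15] = [Balaban1985Variational], [6] = [Balaban1985RegularSpaces], [III] = [Balaban1988Convergent], [I] = [Balaban1987RG1].
Over node00-def-P11's `Node00/Record12BgRowCubeGeometry` (FILE 5 v1.2: `bgRowAt_of_classBounds`, `bgRowAt_of_thm1ScaledSep`, `hcubeΩ_of_compatible`, `plaqSmallOn_UbgMSOfRecord_of_thm1ScaledSep`,
`localGauge_cubesI_of_classBound`, `ofBackgroundC_UbgMSOfRecord_mem_spaceI∕MS_of_classBound`, `condII238_cubesMS_of_classBounds`), node00-def-K0a's `Node00/Record13SepBgRowOfThm1C`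
(`Stage13Params.bgSepAt_of_thm1ScaledSep`, `UbgOfRecord₁₃_succ`, `alphaPos₁₃_of_inInterval`), and this seat's p618164 `…N11OneBlockLevels` (`cubeEnl_subset_of_meets_unionsOfCubes_of_dvd_or_le`,
`pow_dvd_two_mul_pow_or_lt`).

WHY THIS FILE.  p615408 ∕ p617030 ∕ p621363 LOCATED the «hole below the floor» — K1⁸'s consequent asks the record's §2 form at runs whose top 𝐃-cubes do not fit the torus — and
p618164 ∕ p619264 ∕ the memo (EVIDENCE #58 on 20542) traced the run guard `PartCompat₁₃` into dag-n11-d's faces to ONE consumer: K0's proviso row `bg` (`Provisos₁₃Sep.bg`, guarded by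
the window AND `PartCompat₁₃`).  Plan g85 WORD-2 priced it: road (α) «supply `bg` at one-block levels», piece BG-ONEBLOCK.  FIRST-HAND READING OF THE SUPPLIER (this file's point): in
K0's chain the guard (C2) enters ONLY through `hcubeΩ_of_compatible` (`Record12BgRowCubeGeometry` :579, the `spaceI` branch of `bgRowAt_of_classBounds`), whose content is K0b's
saturation `cubeEnl_subset_of_meets_unionsOfCubes … hSN …` — and p618164 showed that conclusion holds at EVERY level once the 𝐃_j-side is a power of `L` (compatible level: K0b's
argument; one-block level: `Λ_j(s) ∈ {∅, T_η}`).  The named fact `VariationalThm1ScaledSep` ([15] Thm 1 (8), a GLOBAL multi-scale constrained variational statement on `T_η`) reads no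
partition; the no-wrap letter `hsN` concerns the (1.12) `L^{n}M`-cubes, `n ≤ k + 1`, which stay below the torus period whenever `a + 1 ≤ m` (true at the witness: g3's volume floor
`j + 1 ≤ F.m`), one-block 𝐃-levels included.  HENCE the whole chain re-runs with `hC2 ↦ hMa : M = F.L^a`: §1 `hcubeΩ_of_powM`; §2 `bgRowAt_of_classBounds_of_powM` (def-P11's proof
VERBATIM, the one `have hcubeΩ` re-sourced); §3 `bgRowAt_of_thm1ScaledSep_of_powM`; §4 ★★★ `bgSepAt_of_thm1ScaledSep_of_powM` = K0a's ★ with the antecedent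
`PartCompat₁₃ F N θ p n →` DELETED from the conclusion.  So ROW P11 `bg` HOLDS ON EVERY WINDOWED RUN AT EVERY LEVEL — one-block top levels included — from the SAME named fact and
letters K0⁷ already carries: BG-ONEBLOCK costs NO new analysis.  (What it does not do: inhabit `VariationalThm1ScaledSep` or the derivative members `h3I ∕ h3MS` — K0⁷'s ∕ N07's
matter, unchanged; nor re-key `Provisos₁₃Sep.bg`'s TEXT — the guarded row is implied by the unguarded one, so K0a's witnesses may keep their suppliers; consumers below the floor
(dag-n11-d's `…_of_bgReadChargedFibre` socket) can now be fed from this file instead of `hsep.bg … hPC`.)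

WHAT THIS FILE PROVES (0 `sorry`, 0 `def`; def-P11's ∕ K0a's compositions re-run with one line changed; nothing of Bałaban asserted).
§1 ★ `hcubeΩ_of_powM`.  §2 ★★ `bgRowAt_of_classBounds_of_powM`.  §3 ★★ `bgRowAt_of_thm1ScaledSep_of_powM`.  §4 ★★★ `bgSepAt_of_thm1ScaledSep_of_powM` (the v1.2 row P11
body per windowed run, NO `PartCompat₁₃`, at `θ.τ9.M = F.L^a`).

HONEST FRAMING.  Helper lane of K1⁸; count-neutral; CONDITIONAL on node00-def-P11's named fact `VariationalThm1ScaledSep` ([15] Thm 1 (8) for separated sequences — a `Prop` hypothesis,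
NEVER asserted), on the displayed derivative members (h3I)∕(h3MS) ([15] Thm 1 (9)–(10)), on (hcomp), (C1), `hsN` and the letter inequalities — exactly K0a's hypotheses minus (C2); nothing of
Bałaban asserted; NOT a discharge of N11 or of K0⁷; K1⁸ NOT closed; counts unmoved (typed 28∕28 · discharged 5∕27).  R4 closes only the conditional finite-𝕋⁴ rung `BalabanLadder.UV` of
one programme at fixed `ε = L^{−K}` — NOT ℝ⁴, NOT OS, NOT a mass gap, NOT Clay.  No `sorry`, `axiom`, `def`, `instance`, `notation`.  Sources (SHAPE ∕ bookkeeping only): [15] Thm 1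
(8)–(10) p.279; [6] (1.3)–(1.8) p.77; [III] (2.1) p.254, (2.5) p.255, (2.7)–(2.8) pp.255–256, p.257, (2.27)–(2.28) p.259, (2.34)–(2.41) p.261; [I] (1.11)–(1.16) p.262.
-/

noncomputable section

open MeasureTheory
open scoped Matrix.Norms.L2Operator

namespace Summit.QuantumFields.YangMills.Theorems.BalabanUVNodesN11BgRowOfPowM

open Literature.MathematicalPhysics.QuantumFieldTheory.Balaban1983to89 T4Continuum Node00
open B14.Eq218Concrete B15DeterminingSets B12RegularSpaces111 B14RegularSpaces234 B14Radii T4AxialGaugeSmallField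
open BalabanUVNodesN11OneBlockLevels (cubeEnl_subset_of_meets_unionsOfCubes_of_dvd_or_le pow_dvd_two_mul_pow_or_lt)

variable {F : T4Family} {N : ℕ} [NeZero N]

/-! ## §1  `hcubeΩ` WITHOUT (C2): every (1.12) cube meeting `X ⊆ Λ_j(s)` lies in `Ω_j(s)` — compatible level by K0b's lemma, one-block level because `Λ_j(s)` is `∅` or the torus -/

/-- **★ FILE 4's `hcubeΩ` FROM (C1) AND `M = L^a` ALONE — NO (C2)**: along a (2.18) index `s`, at every scale `1 ≤ j ≤ k` with (C1) `R_j = L·t_j`, every `L^{j+1}M`-cube of record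
meeting a domain `X ⊆ Λ_j(s)` lies in `Ω_j(s)`.  The 𝐃_j-side `L^j·M·R_j = L^{j+a+s_j}` is a power of `L` ((2.5): `R_j = L^{s_j}`), so EITHER it divides the torus period `2L^{m+K}`
(def-P11's `hcubeΩ_of_compatible` argument: K0b's saturation for nested dividing grids) OR it exceeds it (one block: `Λ_j(s) ∈ 𝐃_j` is `∅` or `T_η`, p618164); in both cases the cube lies
in `Λ_j(s) ⊆ Ω_j(s)`. [cite: Balaban1988Convergent, (2.1) p.254, (2.5) p.255, p.256–257; Balaban1987RG1, (1.12) p.262] -/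
theorem hcubeΩ_of_powM (ν : Stage7Numerics) {M : ℕ} (hM : 0 < M) {a : ℕ} (hMa : M = F.L ^ a) (g : ℕ → ℝ) (K k : ℕ) (s : SeqOfRecord F ν M g K k)
    (hC1 : ∀ j, 1 ≤ j → j ≤ k → ∃ t : ℕ, 0 < t ∧ RkOfRecord (F.P K).L ν.r (g j) = (F.P K).L * t) :
    ∀ j, 1 ≤ j → j ≤ k → ∀ X : (Sect2.domSys (F.P K) M j).Dom, Sect2.domSites (F.P K) M j X ⊆ s.Λ j →
      ∀ a ∈ cubeIndices (F.P K) (B14.Eq213MaximalDomains.side (F.P K).L M (j + 1)),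
        (cubeEnl (F.P K) (B14.Eq213MaximalDomains.side (F.P K).L M (j + 1)) a 0 ∩ Sect2.domSites (F.P K) M j X).Nonempty →
        cubeEnl (F.P K) (B14.Eq213MaximalDomains.side (F.P K).L M (j + 1)) a 0 ⊆ s.Ω j := by
  intro j h1 hjk X hX c hc hne
  have hL3 : 3 ≤ F.L := by have := F.hL11; omega
  obtain ⟨t, ht, hR⟩ := hC1 j h1 hjk
  have hside : 0 < B14.Eq213MaximalDomains.side (F.P K).L M (j + 1) := by
    unfold B14.Eq213MaximalDomains.side
    exact Nat.mul_pos (Nat.pow_pos (F.P K).L_pos) hM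
  have hS : B14.Eq213MaximalDomains.side (F.P K).L M (j + 1) * t = dCubeSide (F.P K).L M (RkOfRecord (F.P K).L ν.r (g j)) j := by
    unfold B14.Eq213MaximalDomains.side dCubeSide
    rw [hR, pow_succ]
    ring
  have hΛ : s.Λ j ∈ unionsOfCubes (F.P K) (B14.Eq213MaximalDomains.side (F.P K).L M (j + 1) * t) := by
    rw [hS]; exact s.chain.memΛ j h1 hjk
  -- the 𝐃_j-side is a power of `L`: compatible or one-block
  obtain ⟨e, he, -, -⟩ := isRj_RkOfRecord (by rw [T4Family.P_L]; omega : 2 ≤ (F.P K).L) ν.r (g j)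
  have hpow : dCubeSide (F.P K).L M (RkOfRecord (F.P K).L ν.r (g j)) j = F.L ^ (j + a + e) := by
    rw [dCubeSide, hMa, he, T4Family.P_L, pow_add, pow_add]
  have hT : (F.P K).sitesPerDir 0 = 2 * F.L ^ (F.m + K) :=
    BalabanUVNodesN11PartCompatOfCouplings.sitesPerDir_zero_eq (F := F) ⟨K, 0, 0⟩
  have hcases : B14.Eq213MaximalDomains.side (F.P K).L M (j + 1) * t ∣ (F.P K).sitesPerDir 0 ∨
      (F.P K).sitesPerDir 0 ≤ B14.Eq213MaximalDomains.side (F.P K).L M (j + 1) * t := by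
    rw [hS, hpow, hT]
    exact (pow_dvd_two_mul_pow_or_lt hL3 (j + a + e) (F.m + K)).imp id le_of_lt
  have hneΛ : (cubeEnl (F.P K) (B14.Eq213MaximalDomains.side (F.P K).L M (j + 1)) c 0 ∩ s.Λ j).Nonempty :=
    hne.mono (Set.inter_subset_inter_right _ hX)
  exact (cubeEnl_subset_of_meets_unionsOfCubes_of_dvd_or_le hside ht hcases hΛ hc hneΛ).trans (s.chain.Λ_subset j h1 hjk)

/-! ## §2  def-P11's per-sequence assembly from class bounds, `hC2 ↦ hMa` (proof VERBATIM, the one `have hcubeΩ` re-sourced) -/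

/-- **★★ THE ROW'S BODY AT ONE SEQUENCE `s` FROM PER-SCALE CLASS BOUNDS — NO (C2)** (node00-def-P11's `bgRowAt_of_classBounds` with the compatibility hypothesis `hC2` replaced by
`hMa : M = F.L^a`; everything else — hypotheses, conclusion, proof — VERBATIM, the cube geometry supplied by §1). [cite: Balaban1988Convergent, (2.27)–(2.28) p.259, (2.34)–(2.41) p.261, p.256–257; Balaban1985Variational, Thm 1 (8)–(10) p.279; Balaban1987RG1, (1.11)–(1.16) p.262] -/
theorem bgRowAt_of_classBounds_of_powM (S : Sect2.Setting (MatA N) (SU N)) (hι : S.ι = ιSU N) (h𝓜 : S.𝓜 = B12RegularSpaces111SpecialUnitary.suModel N) (hS : S.Laws)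
    (hpos : S.Pos) (ν : Stage7Numerics) {M : ℕ} (hM : 0 < M) (K k : ℕ) (cR : ℝ) {b : ℕ → ℝ} (hb0 : ∀ n, n ≤ k → 0 ≤ b n)
    (s : SeqOfRecord F ν M S.flow.g K k)
    (hclass : ∀ W : MSField (F.P K) (SU N), W ∈ regSuppOfRecord F N ν M S.flow.g K k cR s →
      W ∈ solvableDom (avOfRecord F N K) (regMSOfRecord F N ν K k s.Ω) (genSet s.Ω k) →
      ∀ n, n ≤ k → PlaqSmallOn (omegaPlaqs s.Ω n) (b n * (F.P K).eta n ^ 2) (UbgMSOfRecord F N ν M S.flow.g K k s W))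
    (hα : ∀ n, 1 ≤ n → n ≤ k → 0 < S.lf.alpha0 (S.flow.g n) ∧ 0 < S.lf.alpha1 (S.flow.g n))
    (hbα : ∀ n, 1 ≤ n → n ≤ k → b n ≤ (1 - S.βc) * S.lf.alpha0 (S.flow.g n))
    (hsN : ∀ n, 1 ≤ n → n ≤ k + 1 → ((B14.Eq213MaximalDomains.side (F.P K).L M n : ℕ) : ℤ) < (F.P K).sitesPerDir 0)
    (hcB : 2 * (((F.P K).d - 1 : ℕ) : ℝ) * ((F.P K).L * M) < S.cB) (hBCM : 2 * (((F.P K).d - 1 : ℕ) : ℝ) * M < S.B * S.C * S.Mr)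
    (hsmallI : ∀ j, 1 ≤ j → j ≤ k → (((F.P K).d - 1 : ℕ) : ℝ) * ((F.P K).L * M) * (F.P K).eta j * b j ≤ 1 / 2)
    (hsmallMS : ∀ n, 1 ≤ n → n ≤ k → (((F.P K).d - 1 : ℕ) : ℝ) * M * (F.P K).eta n * b n ≤ 1 / 2)
    (hC1 : ∀ j, 1 ≤ j → j ≤ k → ∃ t : ℕ, 0 < t ∧ RkOfRecord (F.P K).L ν.r (S.flow.g j) = (F.P K).L * t)
    {a : ℕ} (hMa : M = F.L ^ a)
    (h3I : ∀ W : MSField (F.P K) (SU N), W ∈ regSuppOfRecord F N ν M S.flow.g K k cR s →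
      W ∈ solvableDom (avOfRecord F N K) (regMSOfRecord F N ν K k s.Ω) (genSet s.Ω k) →
      ∀ j, 1 ≤ j → j ≤ k → ∀ X : (Sect2.domSys (F.P K) M j).Dom, Sect2.domSites (F.P K) M j X ⊆ s.Λ j →
      ∀ a ∈ cubeIndices (F.P K) (B14.Eq213MaximalDomains.side (F.P K).L M (j + 1)),
        (cubeEnl (F.P K) (B14.Eq213MaximalDomains.side (F.P K).L M (j + 1)) a 0 ∩ Sect2.domSites (F.P K) M j X).Nonempty →
        ∀ q ∈ (Sect2.regionOfSet (F.P K) (cubeEnl (F.P K) (B14.Eq213MaximalDomains.side (F.P K).L M (j + 1)) a 0 ∩ Sect2.domSites (F.P K) M j X)).dpairs,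
          ‖grad ((F.P K).eta j) q.2.1 (fun y => axialPotential (UbgMSOfRecord F N ν M S.flow.g K k s W)
            (boxLo (B14.Eq213MaximalDomains.side (F.P K).L M (j + 1)) a) (boxHi (B14.Eq213MaximalDomains.side (F.P K).L M (j + 1)) a) ((F.P K).eta j)
            ⟨y, q.2.2⟩) q.1‖ < S.cB * S.lf.alpha0 (S.flow.g j))
    (h3MS : ∀ W : MSField (F.P K) (SU N), W ∈ regSuppOfRecord F N ν M S.flow.g K k cR s →
      W ∈ solvableDom (avOfRecord F N K) (regMSOfRecord F N ν K k s.Ω) (genSet s.Ω k) →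
      ∀ j, 1 ≤ j → j ≤ k → ∀ X : (Sect2.domSys (F.P K) M j).Dom, ∀ n, 1 ≤ n → n ≤ j →
      ∀ a ∈ cubeIndices (F.P K) (B14.Eq213MaximalDomains.side (F.P K).L M n),
        (cubeEnl (F.P K) (B14.Eq213MaximalDomains.side (F.P K).L M n) a 0 ∩ Sect2.domSites (F.P K) M j X).Nonempty →
        cubeEnl (F.P K) (B14.Eq213MaximalDomains.side (F.P K).L M n) a 0 ⊆ s.Ω n →
        ∀ q ∈ (Sect2.regionOfSet (F.P K) (cubeEnl (F.P K) (B14.Eq213MaximalDomains.side (F.P K).L M n) a 0 ∩ Sect2.domSites (F.P K) M j X)).dpairs,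
          (((F.P K).L : ℝ) ^ n * (F.P K).eta j) ^ 2 * ‖grad ((F.P K).eta j) q.2.1 (fun y => axialPotential (UbgMSOfRecord F N ν M S.flow.g K k s W)
            (boxLo (B14.Eq213MaximalDomains.side (F.P K).L M n) a) (boxHi (B14.Eq213MaximalDomains.side (F.P K).L M n) a) ((F.P K).eta j) ⟨y, q.2.2⟩) q.1‖ <
            rad238 S.B S.C S.Mr (S.lf.alpha0 (S.flow.g n))) :
    ∀ W : MSField (F.P K) (SU N), W ∈ regSuppOfRecord F N ν M S.flow.g K k cR s → ∀ j, 1 ≤ j → j ≤ k → ∀ X : (Sect2.domSys (F.P K) M j).Dom,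
      (Sect2.domSites (F.P K) M j X ⊆ s.Λ j →
        Sect2.ofBackgroundC S.ι (UbgMSOfRecord F N ν M S.flow.g K k s W) ∈
          Sect2.spaceI S (Sect2.Residual.unit (F.P K) (MatA N)) M j (Sect2.domSites (F.P K) M j X) (S.lf.alpha0 (S.flow.g j)) (S.lf.alpha1 (S.flow.g j))) ∧
      (Sect2.admB (F.P K) ν M S.flow.g s.Ω s.Λ j (Sect2.domSites (F.P K) M j X) = true →
        Sect2.ofBackgroundC S.ι (UbgMSOfRecord F N ν M S.flow.g K k s W) ∈
          Sect2.spaceMS S (Sect2.Residual.unit (F.P K) (MatA N)) M j (Sect2.domSites (F.P K) M j X) s.Ω) := by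
  intro W hW j h1 hjk X
  have hd : (0 : ℝ) ≤ (((F.P K).d - 1 : ℕ) : ℝ) := Nat.cast_nonneg _
  have hηj : 0 < (F.P K).eta j := pow_pos (inv_pos.mpr (Nat.cast_pos.mpr (F.P K).L_pos)) j
  have hbα' : ∀ n, 1 ≤ n → n ≤ k → b n ≤ S.lf.alpha0 (S.flow.g n) := by
    intro n hn1 hnk
    refine (hbα n hn1 hnk).trans ?_
    have h0 := (hα n hn1 hnk).1.le
    nlinarith [hpos.βc_nonneg, h0]
  refine ⟨fun hX => ?_, fun _ => ?_⟩
  · -- the `U^c_j` conjunct: class bound at scale `j`, (1.12)(a)(b) by the axial gauge on the cubes of `X`, (c) displayed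
    have hcubeΩ := hcubeΩ_of_powM (F := F) ν hM hMa S.flow.g K k s hC1 j h1 hjk X hX
    have hloc : W ∈ solvableDom (avOfRecord F N K) (regMSOfRecord F N ν K k s.Ω) (genSet s.Ω k) →
        ∀ C ∈ Sect2.cubesI M j (Sect2.domSites (F.P K) M j X), ∃ u : Site (F.P K) 0 → (MatA N)ˣ, (∀ x, u x ∈ S.𝓜.G) ∧ ∃ A : PBond (F.P K) 0 → MatA N,
          (∀ bd ∈ C.bonds, gaugeU u (fun b' => S.ι (UbgMSOfRecord F N ν M S.flow.g K k s W b')) bd = expI ((F.P K).eta j) (A bd)) ∧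
          (∀ bd ∈ C.bonds, ‖A bd‖ < S.cB * S.lf.alpha0 (S.flow.g j)) ∧
          ∀ q ∈ C.dpairs, ‖grad ((F.P K).eta j) q.2.1 (fun y => A ⟨y, q.2.2⟩) q.1‖ < S.cB * S.lf.alpha0 (S.flow.g j) := by
      intro hsol
      have hclassj : PlaqSmallOn (B8Eq17ClassAkV1.plaqsOf (s.Ω j)) (b j * (F.P K).eta j ^ 2) (UbgMSOfRecord F N ν M S.flow.g K k s W) := by
        have h := hclass W hW hsol j hjk
        rwa [omegaPlaqs_of_ne_zero _ (Nat.one_le_iff_ne_zero.mp h1)] at h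
      have hside := side_pred_mul_eta_le (P := F.P K) M j
      have hα0 : 0 < S.lf.alpha0 (S.flow.g j) := (hα j h1 hjk).1
      have hs0 : (0 : ℝ) ≤ ((B14.Eq213MaximalDomains.side (F.P K).L M (j + 1) - 1 : ℕ) : ℝ) := Nat.cast_nonneg _
      have hbj0 := hb0 j hjk
      have hsmall : (((F.P K).d - 1 : ℕ) : ℝ) * ((B14.Eq213MaximalDomains.side (F.P K).L M (j + 1) - 1 : ℕ) : ℝ) * (b j * (F.P K).eta j ^ 2) ≤ 1 / 2 := by
        calc (((F.P K).d - 1 : ℕ) : ℝ) * ((B14.Eq213MaximalDomains.side (F.P K).L M (j + 1) - 1 : ℕ) : ℝ) * (b j * (F.P K).eta j ^ 2)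
            = (((F.P K).d - 1 : ℕ) : ℝ) * ((((B14.Eq213MaximalDomains.side (F.P K).L M (j + 1) - 1 : ℕ) : ℝ)) * (F.P K).eta j) * (F.P K).eta j * b j := by ring
          _ ≤ (((F.P K).d - 1 : ℕ) : ℝ) * ((F.P K).L * M) * (F.P K).eta j * b j := by gcongr
          _ ≤ 1 / 2 := hsmallI j h1 hjk
      have hcB' : 2 * ((((F.P K).d - 1 : ℕ) : ℝ) * ((B14.Eq213MaximalDomains.side (F.P K).L M (j + 1) - 1 : ℕ) : ℝ) * (b j * (F.P K).eta j ^ 2)) / (F.P K).eta j <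
          S.cB * S.lf.alpha0 (S.flow.g j) := by
        rw [div_lt_iff₀ hηj]
        have hbα := hbα' j h1 hjk
        calc 2 * ((((F.P K).d - 1 : ℕ) : ℝ) * ((B14.Eq213MaximalDomains.side (F.P K).L M (j + 1) - 1 : ℕ) : ℝ) * (b j * (F.P K).eta j ^ 2))
            = (2 * (((F.P K).d - 1 : ℕ) : ℝ) * ((((B14.Eq213MaximalDomains.side (F.P K).L M (j + 1) - 1 : ℕ) : ℝ)) * (F.P K).eta j) * b j) * (F.P K).eta j := by ring
          _ ≤ (2 * (((F.P K).d - 1 : ℕ) : ℝ) * ((F.P K).L * M) * S.lf.alpha0 (S.flow.g j)) * (F.P K).eta j := by gcongr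
          _ < S.cB * S.lf.alpha0 (S.flow.g j) * (F.P K).eta j := by
            have := mul_lt_mul_of_pos_right hcB hα0
            nlinarith
      simp only [hι, h𝓜]
      exact localGauge_cubesI_of_classBound (hsN (j + 1) (by omega) (by omega)) hcubeΩ hbj0 hclassj hsmall hcB' (h3I W hW hsol j h1 hjk X hX)
    exact ofBackgroundC_UbgMSOfRecord_mem_spaceI_of_classBound S hι hS hpos.cB_pos ν M S.flow.g K k s W h1 hjk (hα j h1 hjk).1 (hα j h1 hjk).2 X hX
      (hbα' j h1 hjk) (fun hsol => hclass W hW hsol j hjk) hloc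
  · -- the `Ũ^c_j` conjunct: class bounds at the scales `≤ j`, (2.34) plaquettes, (2.38)(a)(b) by the axial gauge on the layer cubes, (c) displayed
    have h238 : W ∈ solvableDom (avOfRecord F N K) (regMSOfRecord F N ν K k s.Ω) (genSet s.Ω k) →
        CondII238 S.𝓜 (Sect2.frameMS (Sect2.Residual.unit (F.P K) (MatA N)) M j (Sect2.domSites (F.P K) M j X) s.Ω)
          (MSConsts.ofParams (F.P K) S.βc S.B S.C S.Mr j) (fun n => S.lf.alpha0 (S.flow.g n)) (fun b' => S.ι (UbgMSOfRecord F N ν M S.flow.g K k s W b')) := by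
      intro hsol
      have hclassn : ∀ n, 1 ≤ n → n ≤ j →
          PlaqSmallOn (B8Eq17ClassAkV1.plaqsOf (s.Ω n)) (b n * (F.P K).eta n ^ 2) (UbgMSOfRecord F N ν M S.flow.g K k s W) := by
        intro n hn1 hnj
        have h := hclass W hW hsol n (hnj.trans hjk)
        rwa [omegaPlaqs_of_ne_zero _ (Nat.one_le_iff_ne_zero.mp hn1)] at h
      have key : ∀ n, 1 ≤ n → n ≤ j →
          (((F.P K).d - 1 : ℕ) : ℝ) * ((B14.Eq213MaximalDomains.side (F.P K).L M n - 1 : ℕ) : ℝ) * (b n * (F.P K).eta n ^ 2) ≤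
            (((F.P K).d - 1 : ℕ) : ℝ) * M * (F.P K).eta n * b n := by
        intro n hn1 hnj
        have hside := side_pred_mul_eta_le' (P := F.P K) M n
        have hηn : 0 ≤ (F.P K).eta n := (pow_pos (inv_pos.mpr (Nat.cast_pos.mpr (F.P K).L_pos)) n).le
        have hbn0 := hb0 n (hnj.trans hjk)
        calc (((F.P K).d - 1 : ℕ) : ℝ) * ((B14.Eq213MaximalDomains.side (F.P K).L M n - 1 : ℕ) : ℝ) * (b n * (F.P K).eta n ^ 2)
            = (((F.P K).d - 1 : ℕ) : ℝ) * (((B14.Eq213MaximalDomains.side (F.P K).L M n - 1 : ℕ) : ℝ) * (F.P K).eta n) * (F.P K).eta n * b n := by ring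
          _ ≤ (((F.P K).d - 1 : ℕ) : ℝ) * M * (F.P K).eta n * b n := by gcongr
      simp only [hι, h𝓜]
      refine condII238_cubesMS_of_classBounds (fun n hn1 hnj => hsN n hn1 (by omega)) (fun n _ hnj => hb0 n (hnj.trans hjk)) hclassn
        (fun n hn1 hnj => (key n hn1 hnj).trans (hsmallMS n hn1 (hnj.trans hjk))) (fun n hn1 hnj => ?_)
        (fun n hn1 hnj a ha hne hΩ q hq => h3MS W hW hsol j h1 hjk X n hn1 hnj a ha hne hΩ q hq)
      have hα0 := (hα n hn1 (hnj.trans hjk)).1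
      have hside := side_pred_mul_eta_le' (P := F.P K) M n
      have hbn0 := hb0 n (hnj.trans hjk)
      have hbα := hbα' n hn1 (hnj.trans hjk)
      have hLη := L_pow_mul_eta (P := F.P K) n
      rw [mul_div_assoc', div_lt_iff₀ hηj]
      unfold rad238
      calc ((F.P K).L : ℝ) ^ n * (F.P K).eta j * (2 * ((((F.P K).d - 1 : ℕ) : ℝ) * ((B14.Eq213MaximalDomains.side (F.P K).L M n - 1 : ℕ) : ℝ) * (b n * (F.P K).eta n ^ 2)))
          = (2 * (((F.P K).d - 1 : ℕ) : ℝ) * (((B14.Eq213MaximalDomains.side (F.P K).L M n - 1 : ℕ) : ℝ) * (F.P K).eta n) *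
              (((F.P K).L : ℝ) ^ n * (F.P K).eta n) * b n) * (F.P K).eta j := by ring
        _ ≤ (2 * (((F.P K).d - 1 : ℕ) : ℝ) * M * 1 * S.lf.alpha0 (S.flow.g n)) * (F.P K).eta j := by rw [hLη]; gcongr
        _ < S.B * S.C * S.Mr * S.lf.alpha0 (S.flow.g n) * (F.P K).eta j := by
            have := mul_lt_mul_of_pos_right hBCM hα0
            nlinarith
    exact ofBackgroundC_UbgMSOfRecord_mem_spaceMS_of_classBound S hι hS hpos ν M K k s W (fun n hn1 hnj => hα n hn1 (hnj.trans hjk)) X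
      (fun n hn1 hnj => hbα n hn1 (hnj.trans hjk)) (fun hsol n hn1 hnj => hclass W hW hsol n (hnj.trans hjk)) h238

/-! ## §3  The faithful chain at every SEPARATED sequence from `VariationalThm1ScaledSep`, `hC2 ↦ hMa` -/

/-- **★★ THE FAITHFUL CHAIN — NO (C2)** (node00-def-P11's `bgRowAt_of_thm1ScaledSep` with `hC2 ↦ hMa : M = F.L^a`; VERBATIM otherwise). [cite: Balaban1985Variational, Thm 1 (8)–(10) p.279; Balaban1985RegularSpaces, (1.3)–(1.8) p.77; Balaban1988Convergent, (2.7)–(2.8) pp.255–256, (2.27)–(2.28) p.259, (2.34)–(2.41) p.261] -/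
theorem bgRowAt_of_thm1ScaledSep_of_powM {B₃ a₀ a₁ : ℝ} (h15 : VariationalThm1ScaledSep F N B₃ a₀ a₁)
    (S : Sect2.Setting (MatA N) (SU N)) (hι : S.ι = ιSU N) (h𝓜 : S.𝓜 = B12RegularSpaces111SpecialUnitary.suModel N) (hS : S.Laws) (hpos : S.Pos)
    (ν : Stage7Numerics) {M : ℕ} (hM : 0 < M) (K k : ℕ) (cR : ℝ) (hB₃ : 0 ≤ B₃)
    (hnum : ∀ n, n ≤ k → 0 < cR * epsOfRecord ν S.flow.g n ∧ cR * epsOfRecord ν S.flow.g n ≤ a₁ ∧ B₃ * (cR * epsOfRecord ν S.flow.g n) ≤ ν.εreg)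
    (ha₀ : ν.εreg ≤ a₀) (hcomp : ∀ n, n < k → cR * epsOfRecord ν S.flow.g n ≤ 2 * (cR * epsOfRecord ν S.flow.g (n + 1)))
    (hα : ∀ n, 1 ≤ n → n ≤ k → 0 < S.lf.alpha0 (S.flow.g n) ∧ 0 < S.lf.alpha1 (S.flow.g n))
    (hBα : ∀ n, 1 ≤ n → n ≤ k → B₃ * (cR * epsOfRecord ν S.flow.g n) ≤ (1 - S.βc) * S.lf.alpha0 (S.flow.g n))
    (hsN : ∀ n, 1 ≤ n → n ≤ k + 1 → ((B14.Eq213MaximalDomains.side (F.P K).L M n : ℕ) : ℤ) < (F.P K).sitesPerDir 0)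
    (hcB : 2 * (((F.P K).d - 1 : ℕ) : ℝ) * ((F.P K).L * M) < S.cB) (hBCM : 2 * (((F.P K).d - 1 : ℕ) : ℝ) * M < S.B * S.C * S.Mr)
    (hsmallI : ∀ j, 1 ≤ j → j ≤ k → (((F.P K).d - 1 : ℕ) : ℝ) * ((F.P K).L * M) * (F.P K).eta j * (B₃ * (cR * epsOfRecord ν S.flow.g j)) ≤ 1 / 2)
    (hsmallMS : ∀ n, 1 ≤ n → n ≤ k → (((F.P K).d - 1 : ℕ) : ℝ) * M * (F.P K).eta n * (B₃ * (cR * epsOfRecord ν S.flow.g n)) ≤ 1 / 2)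
    (hC1 : ∀ j, 1 ≤ j → j ≤ k → ∃ t : ℕ, 0 < t ∧ RkOfRecord (F.P K).L ν.r (S.flow.g j) = (F.P K).L * t)
    {a : ℕ} (hMa : M = F.L ^ a)
    (s : SeqOfRecord F ν M S.flow.g K k) (hsep : Sect2.SeqSeparated ν.M₁ s)
    (h3I : ∀ W : MSField (F.P K) (SU N), W ∈ regSuppOfRecord F N ν M S.flow.g K k cR s →
      W ∈ solvableDom (avOfRecord F N K) (regMSOfRecord F N ν K k s.Ω) (genSet s.Ω k) →
      ∀ j, 1 ≤ j → j ≤ k → ∀ X : (Sect2.domSys (F.P K) M j).Dom, Sect2.domSites (F.P K) M j X ⊆ s.Λ j →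
      ∀ a ∈ cubeIndices (F.P K) (B14.Eq213MaximalDomains.side (F.P K).L M (j + 1)),
        (cubeEnl (F.P K) (B14.Eq213MaximalDomains.side (F.P K).L M (j + 1)) a 0 ∩ Sect2.domSites (F.P K) M j X).Nonempty →
        ∀ q ∈ (Sect2.regionOfSet (F.P K) (cubeEnl (F.P K) (B14.Eq213MaximalDomains.side (F.P K).L M (j + 1)) a 0 ∩ Sect2.domSites (F.P K) M j X)).dpairs,
          ‖grad ((F.P K).eta j) q.2.1 (fun y => axialPotential (UbgMSOfRecord F N ν M S.flow.g K k s W)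
            (boxLo (B14.Eq213MaximalDomains.side (F.P K).L M (j + 1)) a) (boxHi (B14.Eq213MaximalDomains.side (F.P K).L M (j + 1)) a) ((F.P K).eta j)
            ⟨y, q.2.2⟩) q.1‖ < S.cB * S.lf.alpha0 (S.flow.g j))
    (h3MS : ∀ W : MSField (F.P K) (SU N), W ∈ regSuppOfRecord F N ν M S.flow.g K k cR s →
      W ∈ solvableDom (avOfRecord F N K) (regMSOfRecord F N ν K k s.Ω) (genSet s.Ω k) →
      ∀ j, 1 ≤ j → j ≤ k → ∀ X : (Sect2.domSys (F.P K) M j).Dom, ∀ n, 1 ≤ n → n ≤ j →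
      ∀ a ∈ cubeIndices (F.P K) (B14.Eq213MaximalDomains.side (F.P K).L M n),
        (cubeEnl (F.P K) (B14.Eq213MaximalDomains.side (F.P K).L M n) a 0 ∩ Sect2.domSites (F.P K) M j X).Nonempty →
        cubeEnl (F.P K) (B14.Eq213MaximalDomains.side (F.P K).L M n) a 0 ⊆ s.Ω n →
        ∀ q ∈ (Sect2.regionOfSet (F.P K) (cubeEnl (F.P K) (B14.Eq213MaximalDomains.side (F.P K).L M n) a 0 ∩ Sect2.domSites (F.P K) M j X)).dpairs,
          (((F.P K).L : ℝ) ^ n * (F.P K).eta j) ^ 2 * ‖grad ((F.P K).eta j) q.2.1 (fun y => axialPotential (UbgMSOfRecord F N ν M S.flow.g K k s W)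
            (boxLo (B14.Eq213MaximalDomains.side (F.P K).L M n) a) (boxHi (B14.Eq213MaximalDomains.side (F.P K).L M n) a) ((F.P K).eta j) ⟨y, q.2.2⟩) q.1‖ <
            rad238 S.B S.C S.Mr (S.lf.alpha0 (S.flow.g n))) :
    ∀ W : MSField (F.P K) (SU N), W ∈ regSuppOfRecord F N ν M S.flow.g K k cR s → ∀ j, 1 ≤ j → j ≤ k → ∀ X : (Sect2.domSys (F.P K) M j).Dom,
      (Sect2.domSites (F.P K) M j X ⊆ s.Λ j →
        Sect2.ofBackgroundC S.ι (UbgMSOfRecord F N ν M S.flow.g K k s W) ∈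
          Sect2.spaceI S (Sect2.Residual.unit (F.P K) (MatA N)) M j (Sect2.domSites (F.P K) M j X) (S.lf.alpha0 (S.flow.g j)) (S.lf.alpha1 (S.flow.g j))) ∧
      (Sect2.admB (F.P K) ν M S.flow.g s.Ω s.Λ j (Sect2.domSites (F.P K) M j X) = true →
        Sect2.ofBackgroundC S.ι (UbgMSOfRecord F N ν M S.flow.g K k s W) ∈
          Sect2.spaceMS S (Sect2.Residual.unit (F.P K) (MatA N)) M j (Sect2.domSites (F.P K) M j X) s.Ω) :=
  bgRowAt_of_classBounds_of_powM S hι h𝓜 hS hpos ν hM K k cR (fun n hn => mul_nonneg hB₃ (hnum n hn).1.le) s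
    (fun _ hW hsol => plaqSmallOn_UbgMSOfRecord_of_thm1ScaledSep h15 ν M S.flow.g K k cR s hsep hnum ha₀ hcomp hW hsol)
    hα hBα hsN hcB hBCM hsmallI hsmallMS hC1 hMa h3I h3MS

/-! ## §4  ★★★ BG-ONEBLOCK: K0a's Stage-13 lift with the run guard DELETED -/

/-- **★★★ ROW P11 `bg` AT THE STAGE-13 RECORD ON EVERY WINDOWED RUN AT EVERY LEVEL — NO `PartCompat₁₃`** (node00-def-K0a's `Stage13Params.bgSepAt_of_thm1ScaledSep` with the antecedent
`PartCompat₁₃ F N θ p n →` DELETED from the conclusion and `hM : 0 < θ.τ9.M` sharpened to `hMa : θ.τ9.M = F.L^a`; every other hypothesis and the two guarded memberships VERBATIM): the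
located piece «BG-ONEBLOCK» of plan g85 WORD-2 — one-block top levels (`cubeIndices = {0}`, the all-small history `Λ_j = T_η`) INCLUDED — from the SAME named fact `VariationalThm1ScaledSep`
and letters K0⁷ already carries.  A REDUCTION; nothing of Bałaban asserted. [cite: Balaban1985Variational, Thm 1 (8)–(10) p.279; Balaban1985RegularSpaces, (1.3)–(1.8) p.77; Balaban1988Convergent, (2.7)–(2.8) pp.255–256, (2.27)–(2.28) p.259, (2.34)–(2.41) p.261, p.257; Balaban1987RG1, (1.11)–(1.16) p.262] -/
theorem bgSepAt_of_thm1ScaledSep_of_powM (θ : Stage13Params F N) (hθ : θ.Admissible F N) (hRz : θ.Rz = RzOfRecord F N)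
    {B₃ a₀ a₁ : ℝ} (h15 : VariationalThm1ScaledSep F N B₃ a₀ a₁) (hB₃ : 0 ≤ B₃) {a : ℕ} (hMa : θ.τ9.M = F.L ^ a) (ha₀ : θ.ν.εreg ≤ a₀)
    (hnum : ∀ (p : B12.RunParams) (n : ℕ), n ≤ p.K → Step.InInterval θ.γ n (gOfRecord₁₃ F N θ p) → ∀ m, m ≤ n →
      0 < θ.s2.cR * epsOfRecord θ.ν (gOfRecord₁₃ F N θ p) m ∧ θ.s2.cR * epsOfRecord θ.ν (gOfRecord₁₃ F N θ p) m ≤ a₁ ∧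
        B₃ * (θ.s2.cR * epsOfRecord θ.ν (gOfRecord₁₃ F N θ p) m) ≤ θ.ν.εreg)
    (hcomp : ∀ (p : B12.RunParams) (n : ℕ), n ≤ p.K → Step.InInterval θ.γ n (gOfRecord₁₃ F N θ p) → ∀ m, m < n →
      θ.s2.cR * epsOfRecord θ.ν (gOfRecord₁₃ F N θ p) m ≤ 2 * (θ.s2.cR * epsOfRecord θ.ν (gOfRecord₁₃ F N θ p) (m + 1)))
    (hBα : ∀ (p : B12.RunParams) (n : ℕ), n ≤ p.K → Step.InInterval θ.γ n (gOfRecord₁₃ F N θ p) → ∀ m, 1 ≤ m → m ≤ n →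
      B₃ * (θ.s2.cR * epsOfRecord θ.ν (gOfRecord₁₃ F N θ p) m) ≤ (1 - θ.s2.βc) * (lfOfRecord₁₂ F N θ.toStage12Params).alpha0 (gOfRecord₁₃ F N θ p m))
    (hsN : ∀ (p : B12.RunParams) (n : ℕ), n ≤ p.K → ∀ n', 1 ≤ n' → n' ≤ n + 1 →
      ((B14.Eq213MaximalDomains.side (F.P p.K).L θ.τ9.M n' : ℕ) : ℤ) < (F.P p.K).sitesPerDir 0)
    (hcB : ∀ p : B12.RunParams, 2 * (((F.P p.K).d - 1 : ℕ) : ℝ) * ((F.P p.K).L * θ.τ9.M) < θ.s2.cB)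
    (hBCM : ∀ p : B12.RunParams, 2 * (((F.P p.K).d - 1 : ℕ) : ℝ) * θ.τ9.M < θ.s2.B * θ.s2.C * θ.s2.Mr)
    (hsmallI : ∀ (p : B12.RunParams) (n : ℕ), n ≤ p.K → Step.InInterval θ.γ n (gOfRecord₁₃ F N θ p) → ∀ j, 1 ≤ j → j ≤ n →
      (((F.P p.K).d - 1 : ℕ) : ℝ) * ((F.P p.K).L * θ.τ9.M) * (F.P p.K).eta j * (B₃ * (θ.s2.cR * epsOfRecord θ.ν (gOfRecord₁₃ F N θ p) j)) ≤ 1 / 2)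
    (hsmallMS : ∀ (p : B12.RunParams) (n : ℕ), n ≤ p.K → Step.InInterval θ.γ n (gOfRecord₁₃ F N θ p) → ∀ m, 1 ≤ m → m ≤ n →
      (((F.P p.K).d - 1 : ℕ) : ℝ) * θ.τ9.M * (F.P p.K).eta m * (B₃ * (θ.s2.cR * epsOfRecord θ.ν (gOfRecord₁₃ F N θ p) m)) ≤ 1 / 2)
    (hC1 : ∀ (p : B12.RunParams) (n : ℕ), n ≤ p.K → Step.InInterval θ.γ n (gOfRecord₁₃ F N θ p) → ∀ j, 1 ≤ j → j ≤ n →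
      ∃ t : ℕ, 0 < t ∧ RkOfRecord (F.P p.K).L θ.ν.r (gOfRecord₁₃ F N θ p j) = (F.P p.K).L * t)
    (h3I : ∀ (p : B12.RunParams) (n : ℕ), n ≤ p.K → Step.InInterval θ.γ n (gOfRecord₁₃ F N θ p) →
      ∀ s : SeqOfRecord F θ.ν θ.τ9.M (gOfRecord₁₃ F N θ p) p.K n, Sect2.SeqSeparated θ.ν.M₁ s → ∀ W : MSField (F.P p.K) (SU N),
      W ∈ suppOfRecord₁₃ F N θ p n s → W ∈ solvableDom (avOfRecord F N p.K) (regMSOfRecord F N θ.ν p.K n s.Ω) (genSet s.Ω n) →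
      ∀ j, 1 ≤ j → j ≤ n → ∀ X : (Sect2.domSys (F.P p.K) θ.τ9.M j).Dom, Sect2.domSites (F.P p.K) θ.τ9.M j X ⊆ s.Λ j →
      ∀ a ∈ cubeIndices (F.P p.K) (B14.Eq213MaximalDomains.side (F.P p.K).L θ.τ9.M (j + 1)),
        (cubeEnl (F.P p.K) (B14.Eq213MaximalDomains.side (F.P p.K).L θ.τ9.M (j + 1)) a 0 ∩ Sect2.domSites (F.P p.K) θ.τ9.M j X).Nonempty →
        ∀ q ∈ (Sect2.regionOfSet (F.P p.K) (cubeEnl (F.P p.K) (B14.Eq213MaximalDomains.side (F.P p.K).L θ.τ9.M (j + 1)) a 0 ∩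
            Sect2.domSites (F.P p.K) θ.τ9.M j X)).dpairs,
          ‖grad ((F.P p.K).eta j) q.2.1 (fun y => axialPotential (UbgMSOfRecord F N θ.ν θ.τ9.M (gOfRecord₁₃ F N θ p) p.K n s W)
            (boxLo (B14.Eq213MaximalDomains.side (F.P p.K).L θ.τ9.M (j + 1)) a) (boxHi (B14.Eq213MaximalDomains.side (F.P p.K).L θ.τ9.M (j + 1)) a) ((F.P p.K).eta j) ⟨y, q.2.2⟩) q.1‖ <
            θ.s2.cB * (lfOfRecord₁₂ F N θ.toStage12Params).alpha0 (gOfRecord₁₃ F N θ p j))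
    (h3MS : ∀ (p : B12.RunParams) (n : ℕ), n ≤ p.K → Step.InInterval θ.γ n (gOfRecord₁₃ F N θ p) →
      ∀ s : SeqOfRecord F θ.ν θ.τ9.M (gOfRecord₁₃ F N θ p) p.K n, Sect2.SeqSeparated θ.ν.M₁ s → ∀ W : MSField (F.P p.K) (SU N),
      W ∈ suppOfRecord₁₃ F N θ p n s → W ∈ solvableDom (avOfRecord F N p.K) (regMSOfRecord F N θ.ν p.K n s.Ω) (genSet s.Ω n) →
      ∀ j, 1 ≤ j → j ≤ n → ∀ X : (Sect2.domSys (F.P p.K) θ.τ9.M j).Dom, ∀ m, 1 ≤ m → m ≤ j →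
      ∀ a ∈ cubeIndices (F.P p.K) (B14.Eq213MaximalDomains.side (F.P p.K).L θ.τ9.M m),
        (cubeEnl (F.P p.K) (B14.Eq213MaximalDomains.side (F.P p.K).L θ.τ9.M m) a 0 ∩ Sect2.domSites (F.P p.K) θ.τ9.M j X).Nonempty →
        cubeEnl (F.P p.K) (B14.Eq213MaximalDomains.side (F.P p.K).L θ.τ9.M m) a 0 ⊆ s.Ω m →
        ∀ q ∈ (Sect2.regionOfSet (F.P p.K) (cubeEnl (F.P p.K) (B14.Eq213MaximalDomains.side (F.P p.K).L θ.τ9.M m) a 0 ∩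
            Sect2.domSites (F.P p.K) θ.τ9.M j X)).dpairs,
          (((F.P p.K).L : ℝ) ^ m * (F.P p.K).eta j) ^ 2 *
            ‖grad ((F.P p.K).eta j) q.2.1 (fun y => axialPotential (UbgMSOfRecord F N θ.ν θ.τ9.M (gOfRecord₁₃ F N θ p) p.K n s W)
              (boxLo (B14.Eq213MaximalDomains.side (F.P p.K).L θ.τ9.M m) a) (boxHi (B14.Eq213MaximalDomains.side (F.P p.K).L θ.τ9.M m) a) ((F.P p.K).eta j) ⟨y, q.2.2⟩) q.1‖ <
            rad238 θ.s2.B θ.s2.C θ.s2.Mr ((lfOfRecord₁₂ F N θ.toStage12Params).alpha0 (gOfRecord₁₃ F N θ p m))) :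
    ∀ (p : B12.RunParams) (n : ℕ), n ≤ p.K → Step.InInterval θ.γ n (gOfRecord₁₃ F N θ p) →
      ∀ s : SeqOfRecord F θ.ν θ.τ9.M (gOfRecord₁₃ F N θ p) p.K n, Sect2.SeqSeparated θ.ν.M₁ s →
      ∀ W : MSField (F.P p.K) (SU N), W ∈ suppOfRecord₁₃ F N θ p n s →
      ∀ j, 1 ≤ j → j ≤ n → ∀ X : (Sect2.domSys (F.P p.K) θ.τ9.M j).Dom,
      (Sect2.domSites (F.P p.K) θ.τ9.M j X ⊆ s.Λ j →
        Sect2.ofBackgroundC (settingOfRecord₁₃ F N θ p).ι (UbgOfRecord₁₃ F N θ p n s W) ∈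
          Sect2.spaceI (settingOfRecord₁₃ F N θ p) (θ.Rz p.K) θ.τ9.M j (Sect2.domSites (F.P p.K) θ.τ9.M j X)
            ((settingOfRecord₁₃ F N θ p).lf.alpha0 ((settingOfRecord₁₃ F N θ p).flow.g j)) ((settingOfRecord₁₃ F N θ p).lf.alpha1 ((settingOfRecord₁₃ F N θ p).flow.g j))) ∧
      (Sect2.admB (F.P p.K) θ.ν θ.τ9.M (gOfRecord₁₃ F N θ p) s.Ω s.Λ j (Sect2.domSites (F.P p.K) θ.τ9.M j X) = true →
        Sect2.ofBackgroundC (settingOfRecord₁₃ F N θ p).ι (UbgOfRecord₁₃ F N θ p n s W) ∈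
          Sect2.spaceMS (settingOfRecord₁₃ F N θ p) (θ.Rz p.K) θ.τ9.M j (Sect2.domSites (F.P p.K) θ.τ9.M j X) s.Ω) := by
  intro p n hn hw
  have hM : 0 < θ.τ9.M := by rw [hMa]; have := F.hL11; positivity
  rw [hRz]
  cases n with
  | zero =>
    intro s _ W _ j h1 hj
    exfalso
    omega
  | succ n =>
    rw [UbgOfRecord₁₃_succ]
    exact fun s hsep W hW j h1 hj X =>
      bgRowAt_of_thm1ScaledSep_of_powM h15 (settingOfRecord₁₃ F N θ p) rfl rfl (settingOfRecord₁₃_laws F N θ p) (settingOfRecord₁₃_pos F N θ hθ.1.pos p)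
        θ.ν hM p.K (n + 1) θ.s2.cR hB₃ (hnum p (n + 1) hn hw) ha₀ (hcomp p (n + 1) hn hw) (fun m _ hm => alphaPos₁₃_of_inInterval hθ hw hm)
        (hBα p (n + 1) hn hw) (hsN p (n + 1) hn) (hcB p) (hBCM p) (hsmallI p (n + 1) hn hw) (hsmallMS p (n + 1) hn hw) (hC1 p (n + 1) hn hw)
        hMa s hsep (h3I p (n + 1) hn hw s hsep) (h3MS p (n + 1) hn hw s hsep) W hW j h1 hj X

end Summit.QuantumFields.YangMills.Theorems.BalabanUVNodesN11BgRowOfPowM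

end
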